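import Mathlib.Topology.Homeomorph.Lemmas
import Mathlib.Topology.ContinuousMap.Basic
import HarnessLib

/-!
# Gluing local trivialisations over open-and-closed pieces of the total space

Topic `Literature/AlgebraicTopology/Homotopy`. A purely topological bookkeeping step used to apply
Ehresmann's fibration theorem (Bröcker–Jänich (8.12), the tree's `ehresmann_fibration_holds`: a
proper submersion of manifolds OF ONE FIXED DIMENSION is locally trivial) to a proper submersion
whose total space is a disjoint union of manifolds of different dimensions — e.g. the complex points
of a smooth proper, not necessarily equidimensional, family of varieties (Voisin I Thm. 9.3 as used
for `Motives.Voisin2002_tubeRestrict_isIso`).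

`Literature.AlgebraicTopology.Homotopy.exists_trivialization_of_pieces`: let `p : X → Y` be
continuous, `e : M → Y` an open embedding (a chart domain of the base) and `j_i : E_i → X`,
`i ∈ ι` finite, open embeddings with pairwise disjoint images covering `p⁻¹(e(M))`, over maps
`q_i : E_i → M` (`p ∘ j_i = e ∘ q_i`). If every `q_i` is trivial near `m₀` — a homeomorphism
`U_i × q_i⁻¹(m₀) ≃ₜ q_i⁻¹(U_i)` over an open `U_i ∋ m₀` — then `p` is trivial over every subset
`V` of `V₀ = e(⋂ U_i)`: there is `φ : V × p⁻¹(e m₀) ≃ₜ p⁻¹(V)` over `V`, obtained by gluing the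
`j_i ∘ ψ_i` (the pieces `{x ∈ range j_i}` are open and closed, so the glued maps are continuous:
Mathlib `ContinuousMap.liftCover`). Everything is proved; no named facts.

## References

* Th. Bröcker, K. Jänich, *Introduction to Differential Topology*, CUP 1982, (8.12).
  [BrockerJanichIDT1982]
* C. Voisin, *Hodge Theory and Complex Algebraic Geometry I*, CUP 2002, Thm. 9.3, §9.2.1.
  [VoisinHodgeI2002]
-/

noncomputable section

open Set Function Topology Filter

namespace Literature.AlgebraicTopology.Homotopy

universe u v w t

/-- **Gluing local trivialisations over open-and-closed pieces.** See the module docstring: `p`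
continuous, `e` an open embedding of the base chart `M`, `j_i` (`i ∈ ι`, finite) open embeddings of
the pieces `E_i` into `X` with pairwise disjoint images covering `p⁻¹(e(M))`, lying over
`q_i : E_i → M`; if each `q_i` is trivial over an open `U_i ∋ m₀` then `p` is trivial over every
`V ⊆ e(⋂ U_i)`, with fibre `p⁻¹(e m₀)`. [cite: BrockerJanichIDT1982, (8.12)] -/
theorem exists_trivialization_of_pieces
    {X : Type u} {Y : Type v} {M : Type w} [TopologicalSpace X] [TopologicalSpace Y]
    [TopologicalSpace M] {ι : Type t} [Finite ι] {E : ι → Type u} [∀ i, TopologicalSpace (E i)]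
    (p : X → Y) (hp : Continuous p) (e : M → Y) (he : IsOpenEmbedding e)
    (j : ∀ i, E i → X) (hj : ∀ i, IsOpenEmbedding (j i))
    (hdisj : ∀ i i' (z : E i) (z' : E i'), j i z = j i' z' → i = i')
    (hcover : ∀ x, p x ∈ range e → ∃ i, x ∈ range (j i))
    (q : ∀ i, E i → M) (hcomm : ∀ i z, p (j i z) = e (q i z)) (m₀ : M)
    (htriv : ∀ i, ∃ U : Set M, IsOpen U ∧ m₀ ∈ U ∧
      ∃ ψ : U × (q i ⁻¹' {m₀}) ≃ₜ q i ⁻¹' U, ∀ z, q i (ψ z) = z.1) :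
    ∃ V₀ : Set Y, IsOpen V₀ ∧ e m₀ ∈ V₀ ∧ ∀ V : Set Y, V ⊆ V₀ →
      ∃ φ : V × (p ⁻¹' {e m₀}) ≃ₜ p ⁻¹' V, ∀ z, p (φ z : X) = z.1 := by
  classical
  choose U hUo hm₀ ψ hψ using htriv
  -- the homeomorphisms onto the images of the open embeddings
  let eH : M ≃ₜ range e := he.isEmbedding.toHomeomorph
  have heH : ∀ m, (eH m : Y) = e m := fun m ↦ rfl
  have heH' : ∀ y : range e, e (eH.symm y) = y := fun y ↦
    calc e (eH.symm y) = (eH (eH.symm y) : Y) := rfl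
      _ = y := by rw [eH.apply_symm_apply]
  let jH : ∀ i, E i ≃ₜ range (j i) := fun i ↦ (hj i).isEmbedding.toHomeomorph
  have hjH' : ∀ i (x : range (j i)), j i ((jH i).symm x) = x := fun i x ↦
    calc j i ((jH i).symm x) = ((jH i) ((jH i).symm x) : X) := rfl
      _ = x := by rw [(jH i).apply_symm_apply]
  have hjH : ∀ i (z : E i) (h : j i z ∈ range (j i)), (jH i).symm ⟨j i z, h⟩ = z := fun i z h ↦
    (hj i).isEmbedding.toHomeomorph_symm_apply z
  -- `V₀ = e (⋂ Uᵢ)`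
  refine ⟨e '' ⋂ i, U i, he.isOpenMap _ (isOpen_iInter_of_finite hUo), ⟨m₀, mem_iInter.2 hm₀, rfl⟩,
    fun V hV ↦ ?_⟩
  have hVe : V ⊆ range e := hV.trans (image_subset_range _ _)
  have hVU : ∀ {y} (hy : y ∈ V) (i), eH.symm ⟨y, hVe hy⟩ ∈ U i := fun {y} hy i ↦ by
    obtain ⟨m, hm, rfl⟩ := hV hy
    rw [show eH.symm ⟨e m, hVe hy⟩ = m from he.isEmbedding.toHomeomorph_symm_apply m]
    exact mem_iInter.1 hm i
  -- points over `e m₀` read in the piece `i` lie in `qᵢ⁻¹(m₀)`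
  have hfib : ∀ i (x : X) (hx : p x = e m₀) (h : x ∈ range (j i)), q i ((jH i).symm ⟨x, h⟩) = m₀ :=
    fun i x hx h ↦ he.injective (by rw [← hcomm, hjH', hx])
  -- every point of `p⁻¹ V` or of `p⁻¹ (e m₀)` lies in exactly one piece
  have hcovV : ∀ x : p ⁻¹' V, ∃ i, (x : X) ∈ range (j i) := fun x ↦ hcover x (hVe x.2)
  have hcov₀ : ∀ x : p ⁻¹' {e m₀}, ∃ i, (x : X) ∈ range (j i) := fun x ↦
    hcover x (by rw [show p x = e m₀ from x.2]; exact mem_range_self _)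
  have huniq : ∀ {i i'} {x : X}, x ∈ range (j i) → x ∈ range (j i') → i = i' := by
    rintro i i' x ⟨z, rfl⟩ ⟨z', hz'⟩
    exact hdisj i i' z z' hz'.symm
  /- the forward map on the piece `i`: `(v, x) ↦ jᵢ (ψᵢ (e⁻¹ v, jᵢ⁻¹ x))` -/
  let S : ι → Set (V × p ⁻¹' {e m₀}) := fun i ↦ {z | (z.2 : X) ∈ range (j i)}
  have hSo : ∀ i, IsOpen (S i) := fun i ↦
    (hj i).isOpen_range.preimage (continuous_subtype_val.comp continuous_snd)
  let F : ∀ i, S i → X := fun i z ↦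
    j i (ψ i (⟨eH.symm ⟨(z.1.1 : Y), hVe z.1.1.2⟩, hVU z.1.1.2 i⟩,
      ⟨(jH i).symm ⟨(z.1.2 : X), z.2⟩, hfib i _ z.1.2.2 z.2⟩))
  have hFp : ∀ i (z : S i), p (F i z) = (z.1.1 : Y) := fun i z ↦ by
    simp only [F, hcomm, hψ]
    exact heH' _
  have hFc : ∀ i, Continuous (F i) := fun i ↦ by
    refine (hj i).continuous.comp ((continuous_subtype_val.comp (ψ i).continuous).comp ?_)
    refine Continuous.prodMk ?_ ?_
    · exact (eH.symm.continuous.comp ((continuous_subtype_val.comp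
        (continuous_fst.comp continuous_subtype_val)).subtype_mk _)).subtype_mk _
    · exact ((jH i).symm.continuous.comp ((continuous_subtype_val.comp
        (continuous_snd.comp continuous_subtype_val)).subtype_mk _)).subtype_mk _
  have hFmem : ∀ i (z : S i), F i z ∈ p ⁻¹' V := fun i z ↦ by
    rw [mem_preimage, hFp]; exact z.1.1.2
  let Fc : ∀ i, C(S i, p ⁻¹' V) := fun i ↦
    ⟨fun z ↦ ⟨F i z, hFmem i z⟩, (hFc i).subtype_mk (hFmem i)⟩
  have hFcompat : ∀ i i' (z) (hi : z ∈ S i) (hi' : z ∈ S i'), Fc i ⟨z, hi⟩ = Fc i' ⟨z, hi'⟩ := by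
    intro i i' z hi hi'
    obtain rfl : i = i' := huniq hi hi'
    rfl
  have hScov : ∀ z, ∃ i, S i ∈ 𝓝 z := fun z ↦ by
    obtain ⟨i, hi⟩ := hcov₀ z.2
    exact ⟨i, (hSo i).mem_nhds hi⟩
  let Φ : C(V × p ⁻¹' {e m₀}, p ⁻¹' V) := ContinuousMap.liftCover S Fc hFcompat hScov
  have hΦ : ∀ i (z) (hi : z ∈ S i), Φ z = Fc i ⟨z, hi⟩ := fun i z hi ↦
    ContinuousMap.liftCover_coe (S := S) (hφ := hFcompat) (hS := hScov) ⟨z, hi⟩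
  /- the backward map on the piece `i`: `x ↦ (p x, jᵢ (pr₂ (ψᵢ⁻¹ (jᵢ⁻¹ x))))` -/
  let T : ι → Set (p ⁻¹' V) := fun i ↦ {x | (x : X) ∈ range (j i)}
  have hTo : ∀ i, IsOpen (T i) := fun i ↦ (hj i).isOpen_range.preimage continuous_subtype_val
  have hqU : ∀ i (x : T i), q i ((jH i).symm ⟨(x.1 : X), x.2⟩) ∈ U i := fun i x ↦ by
    have h1 : e (q i ((jH i).symm ⟨(x.1 : X), x.2⟩)) = p x.1 := by rw [← hcomm, hjH']
    have h2 : eH.symm ⟨p x.1, hVe x.1.2⟩ = q i ((jH i).symm ⟨(x.1 : X), x.2⟩) := by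
      have h3 : (⟨p x.1, hVe x.1.2⟩ : range e) = ⟨e _, mem_range_self _⟩ := Subtype.ext h1.symm
      rw [h3]
      exact he.isEmbedding.toHomeomorph_symm_apply _
    rw [← h2]
    exact hVU x.1.2 i
  -- the fibre coordinate of `x` in the piece `i`
  let G₂ : ∀ i, T i → X := fun i x ↦
    j i ((ψ i).symm ⟨(jH i).symm ⟨(x.1 : X), x.2⟩, hqU i x⟩).2
  have hG₂mem : ∀ i (x : T i), G₂ i x ∈ p ⁻¹' {e m₀} := fun i x ↦ by
    simp only [G₂, mem_preimage, hcomm, mem_singleton_iff]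
    exact congrArg e ((ψ i).symm ⟨(jH i).symm ⟨(x.1 : X), x.2⟩, hqU i x⟩).2.2
  have hG₂c : ∀ i, Continuous (G₂ i) := fun i ↦ by
    refine (hj i).continuous.comp (continuous_subtype_val.comp (continuous_snd.comp
      ((ψ i).symm.continuous.comp ?_)))
    exact ((jH i).symm.continuous.comp
      ((continuous_subtype_val.comp continuous_subtype_val).subtype_mk _)).subtype_mk _
  have hG₁mem : ∀ i (x : T i), p (x.1 : X) ∈ V := fun i x ↦ x.1.2
  let G : ∀ i, T i → V × p ⁻¹' {e m₀} := fun i x ↦ (⟨p x.1, hG₁mem i x⟩, ⟨G₂ i x, hG₂mem i x⟩)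
  have hGc : ∀ i, Continuous (G i) := fun i ↦
    ((hp.comp (continuous_subtype_val.comp continuous_subtype_val)).subtype_mk (hG₁mem i)).prodMk
      ((hG₂c i).subtype_mk (hG₂mem i))
  let Gc : ∀ i, C(T i, V × p ⁻¹' {e m₀}) := fun i ↦ ⟨G i, hGc i⟩
  have hGcompat : ∀ i i' (x) (hi : x ∈ T i) (hi' : x ∈ T i'), Gc i ⟨x, hi⟩ = Gc i' ⟨x, hi'⟩ := by
    intro i i' x hi hi'
    obtain rfl : i = i' := huniq hi hi'
    rfl
  have hTcov : ∀ x, ∃ i, T i ∈ 𝓝 x := fun x ↦ by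
    obtain ⟨i, hi⟩ := hcovV x
    exact ⟨i, (hTo i).mem_nhds hi⟩
  let Ψ : C(p ⁻¹' V, V × p ⁻¹' {e m₀}) := ContinuousMap.liftCover T Gc hGcompat hTcov
  have hΨ : ∀ i (x) (hi : x ∈ T i), Ψ x = Gc i ⟨x, hi⟩ := fun i x hi ↦
    ContinuousMap.liftCover_coe (S := T) (hφ := hGcompat) (hS := hTcov) ⟨x, hi⟩
  /- the two maps are inverse to each other -/
  have hleft : ∀ z, Ψ (Φ z) = z := fun z ↦ by
    obtain ⟨i, hi⟩ := hcov₀ z.2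
    have hΦz : Φ z = Fc i ⟨z, hi⟩ := hΦ i z hi
    have hmem : ((Φ z : p ⁻¹' V) : X) ∈ range (j i) := by rw [hΦz]; exact mem_range_self _
    rw [hΨ i (Φ z) hmem]
    -- abbreviations
    set w : U i := ⟨eH.symm ⟨(z.1 : Y), hVe z.1.2⟩, hVU z.1.2 i⟩ with hw
    set y : q i ⁻¹' {m₀} := ⟨(jH i).symm ⟨(z.2 : X), hi⟩, hfib i _ z.2.2 hi⟩ with hy
    have hval : ((Φ z : p ⁻¹' V) : X) = j i (ψ i (w, y)) := by rw [hΦz]; rfl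
    have hkey : (jH i).symm ⟨((Φ z : p ⁻¹' V) : X), hmem⟩ = (ψ i (w, y) : E i) := by
      have h3 : (⟨((Φ z : p ⁻¹' V) : X), hmem⟩ : range (j i)) = ⟨j i _, mem_range_self _⟩ :=
        Subtype.ext hval
      rw [h3]
      exact hjH i _ _
    have hsymm : (ψ i).symm ⟨(jH i).symm ⟨((Φ z : p ⁻¹' V) : X), hmem⟩, hqU i ⟨Φ z, hmem⟩⟩ = (w, y) := by
      have h4 : (⟨(jH i).symm ⟨((Φ z : p ⁻¹' V) : X), hmem⟩, hqU i ⟨Φ z, hmem⟩⟩ : q i ⁻¹' U i) =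
          ψ i (w, y) := Subtype.ext hkey
      rw [h4, Homeomorph.symm_apply_apply]
    refine Prod.ext (Subtype.ext ?_) (Subtype.ext ?_)
    · show p ((Φ z : p ⁻¹' V) : X) = z.1
      rw [hΦz]
      exact hFp i ⟨z, hi⟩
    · show j i ((ψ i).symm ⟨(jH i).symm ⟨((Φ z : p ⁻¹' V) : X), hmem⟩, hqU i ⟨Φ z, hmem⟩⟩).2 = z.2
      rw [hsymm]
      exact hjH' i ⟨_, hi⟩
  have hright : ∀ x, Φ (Ψ x) = x := fun x ↦ by
    obtain ⟨i, hi⟩ := hcovV x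
    have hΨx : Ψ x = Gc i ⟨x, hi⟩ := hΨ i x hi
    set y' : q i ⁻¹' U i := ⟨(jH i).symm ⟨(x : X), hi⟩, hqU i ⟨x, hi⟩⟩ with hy'
    have hsnd : (((Ψ x).2 : p ⁻¹' {e m₀}) : X) = j i ((ψ i).symm y').2 := by rw [hΨx]; rfl
    have hfst : (((Ψ x).1 : V) : Y) = p x := by rw [hΨx]; rfl
    have hmem : (((Ψ x).2 : p ⁻¹' {e m₀}) : X) ∈ range (j i) := by rw [hsnd]; exact mem_range_self _
    rw [hΦ i (Ψ x) hmem]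
    apply Subtype.ext
    show F i ⟨Ψ x, hmem⟩ = x
    simp only [F]
    have h1 : (jH i).symm ⟨(((Ψ x).2 : p ⁻¹' {e m₀}) : X), hmem⟩ = (((ψ i).symm y').2 : E i) := by
      have h3 : (⟨(((Ψ x).2 : p ⁻¹' {e m₀}) : X), hmem⟩ : range (j i)) = ⟨j i _, mem_range_self _⟩ :=
        Subtype.ext hsnd
      rw [h3]
      exact hjH i _ _
    have h2 : eH.symm ⟨(((Ψ x).1 : V) : Y), hVe ((Ψ x).1).2⟩ = (((ψ i).symm y').1 : M) := by
      have h4 : q i (ψ i ((ψ i).symm y')) = ((ψ i).symm y').1 := hψ i _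
      rw [Homeomorph.apply_symm_apply] at h4
      -- `q i (jᵢ⁻¹ x) = pr₁ (ψᵢ⁻¹ y')` and `e` of it is `p x`
      have h5 : e (((ψ i).symm y').1 : M) = p x := by rw [← h4, hy', ← hcomm, hjH']
      have h6 : (⟨(((Ψ x).1 : V) : Y), hVe ((Ψ x).1).2⟩ : range e) = ⟨e _, mem_range_self _⟩ :=
        Subtype.ext (hfst.trans h5.symm)
      rw [h6]
      exact he.isEmbedding.toHomeomorph_symm_apply _
    have h7 : (⟨eH.symm ⟨(((Ψ x).1 : V) : Y), hVe ((Ψ x).1).2⟩, hVU ((Ψ x).1).2 i⟩ : U i) =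
        ((ψ i).symm y').1 := Subtype.ext h2
    have h8 : (⟨(jH i).symm ⟨(((Ψ x).2 : p ⁻¹' {e m₀}) : X), hmem⟩,
        hfib i _ ((Ψ x).2).2 hmem⟩ : q i ⁻¹' {m₀}) = ((ψ i).symm y').2 := Subtype.ext h1
    rw [h7, h8, Prod.mk.eta, Homeomorph.apply_symm_apply]
    exact hjH' i ⟨x, hi⟩
  refine ⟨{ toFun := Φ
            invFun := Ψ
            left_inv := hleft
            right_inv := hright
            continuous_toFun := Φ.continuous
            continuous_invFun := Ψ.continuous }, fun z ↦ ?_⟩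
  obtain ⟨i, hi⟩ := hcov₀ z.2
  show p ((Φ z : p ⁻¹' V) : X) = z.1
  rw [hΦ i z hi]
  exact hFp i ⟨z, hi⟩

end Literature.AlgebraicTopology.Homotopy

end
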